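import Literature.NumberTheory.Automorphic.ArchCongruenceTransport      -- ★ `archFormOf_formCongr`, `coe_archCongr_apply` (the arch congruence iso as a TERM)
import Literature.NumberTheory.Automorphic.UnitaryGroupLevelTransport    -- ★ `UnitaryGroup.finAdelicCongr`, `toFinAdeleGL`
import Literature.NumberTheory.Automorphic.UnitaryGroupAdelicProduct     -- ★ `UnitaryGroup.archPart`, `finPart`, `adelicProdEquiv`
import Literature.NumberTheory.Automorphic.AdelicUnitaryGroupDatum       -- ★ `UnitaryGroup.cmDatum` (`cmDatum_Adelic` rfl)
import HarnessLib

/-!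
# A rational congruence commutes with the archimedean ∕ finite-adelic decomposition of `U(H)(𝔸)`

Topic `NumberTheory/Automorphic`; namespace `Literature.NumberTheory.Automorphic.UnitaryGroup`.  THEOREMS ONLY (no definition, no instance,
no notation, no named fact, no `sorry`).  Bookkeeping companion of ★ `AdelicUnitaryGroup.adelicUnitaryGroupCongr` (the adelic congruence
`E = (x ↦ Q_𝔸 x Q_𝔸⁻¹) : U(H′)(𝔸_{L⁺}) ≃ₜ* U(H₀)(𝔸_{L⁺})` of a RATIONAL congruence `ᵗ(cQ)·H₀·Q = H′`, `Q ∈ GL_N(L)`), ★ `ArchCongruenceTransport`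
(the archimedean congruence iso is the TERM `unitaryGroupOfFormCongrOfEq (conjMixed) (Q ⊗ 1) (archFormOf H₀) (archFormOf H′) hS`, `y ↦ (Q ⊗ 1) y (Q ⊗ 1)⁻¹`),
★ `UnitaryGroupLevelTransport.finAdelicCongr` (`z ↦ Q_f z Q_f⁻¹`) and ★ `UnitaryGroupAdelicProduct` (`archPart`, `finPart`, `adelicProdEquiv`): for a CM field `L`,

* §1 `toMixed_toAdeleGL` «`(Q_𝔸)_∞ = Q ⊗ 1`» and `sndHom_toAdeleGL` «`(Q_𝔸)_f = Q_f`» for an ARBITRARY `Q ∈ GL_N(L)` (the congruence matrix is not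
  unitary, so the rational-point junctions ★ `archPart_toAdelic` ∕ `finPart_toAdelic` do not apply verbatim; same two-line proofs at the `GL_N` level);
* §2 **`archPart_adelicUnitaryGroupCongr`** «`(Q_𝔸 x Q_𝔸⁻¹)_∞ = (Q ⊗ 1) x_∞ (Q ⊗ 1)⁻¹`», **`finPart_adelicUnitaryGroupCongr`** «`(Q_𝔸 x Q_𝔸⁻¹)_f = Q_f x_f Q_f⁻¹`»,
  `formCongr_complexConj_one_smul` (the `finAdelicCongr` hypothesis from the `adelicUnitaryGroupCongr` one), and the product forms
  **`adelicProdEquiv_adelicUnitaryGroupCongr`** «`e_{H₀}(E x) = (Ψ (e_{H′} x).1, E_f (e_{H′} x).2)`» and **`adelicUnitaryGroupCongr_adelicProdEquiv_symm`**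
  «`E (e_{H′}⁻¹ (y, z)) = e_{H₀}⁻¹ (Ψ y, E_f z)`» — the shape in which a measure on `U(H′)(𝔸)` given as an `e⁻¹`-image of a product measure is
  transported along `E` (Weil-tower frame transport of the singular covolume letters, Rogawski 1990 §14.5).

## References
* [PlatonovRapinchuk1994] V. Platonov, A. Rapinchuk, *Algebraic Groups and Number Theory*, Academic Press (1994), §2.3 (equivalent hermitian forms have
  conjugate unitary groups), §5.1 (adelic points, `G(𝔸) = G_∞ × G(𝔸_f)`).
* [BorelJacquet1979] A. Borel, H. Jacquet, *Automorphic forms and automorphic representations*, PSPM 33.1 (1979), §4.1 (`g = g_∞ g_f`).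
* [Rogawski1990] J. Rogawski, *Automorphic Representations of Unitary Groups in Three Variables*, Ann. of Math. Stud. 123 (1990), §14.5 p. 239 (use).
-/

set_option autoImplicit false

noncomputable section

open NumberField NumberField.InfinitePlace NumberField.mixedEmbedding IsDedekindDomain
open scoped Matrix MatrixGroups

namespace Literature.NumberTheory.Automorphic

namespace UnitaryGroup

section CM

variable (L : Type) [Field L] [NumberField L] [IsCMField L] {N : ℕ}

/-! ## §1 The components of the diagonal image of an arbitrary `Q ∈ GL_N(L)` -/

omit [IsCMField L] in
/-- **`(Q_𝔸)_∞ = Q ⊗ 1`**: the archimedean component (★ `GLn.toMixed`) of the diagonal image `toAdeleGL L Q ∈ GL_N(𝔸_L)` of ANY `Q ∈ GL_N(L)` is its mixed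
embedding (Mathlib `InfiniteAdeleRing.mixedEmbedding_eq_algebraMap_comp`, entrywise; the rational-point case is ★ `archPart_toAdelic`).
[cite: BorelJacquet1979, §4.1] -/
theorem toMixed_toAdeleGL (Q : GL (Fin N) L) :
    GLn.toMixed N L (toAdeleGL L Q) = Matrix.GeneralLinearGroup.map (mixedEmbedding L) Q := by
  refine Matrix.GeneralLinearGroup.ext fun i j => ?_
  show InfiniteAdeleRing.ringEquiv_mixedSpace L
      ((algebraMap L (AdeleRing (𝓞 L) L) (((Q : GL (Fin N) L) : Matrix (Fin N) (Fin N) L) i j)).1) =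
    NumberField.mixedEmbedding L (((Q : GL (Fin N) L) : Matrix (Fin N) (Fin N) L) i j)
  rw [InfiniteAdeleRing.mixedEmbedding_eq_algebraMap_comp]
  rfl

omit [IsCMField L] in
/-- **`(Q_𝔸)_f = Q_f`**: the finite component (★ `GLn.sndHom`) of the diagonal image of ANY `Q ∈ GL_N(L)` is its finite-adelic diagonal image
(★ `toFinAdeleGL`; definitional, entrywise; the rational-point case is ★ `finPart_toAdelic`). [cite: BorelJacquet1979, §4.1] -/
theorem sndHom_toAdeleGL (Q : GL (Fin N) L) :
    GLn.sndHom N L (toAdeleGL L Q) = toFinAdeleGL L N Q :=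
  Matrix.GeneralLinearGroup.ext fun _ _ => rfl

/-! ## §2 The adelic congruence commutes with `archPart`, `finPart` and `adelicProdEquiv` -/

variable {L}
variable {H₀ H' : Matrix (Fin N) (Fin N) L}

/-- **`(Q_𝔸 x Q_𝔸⁻¹)_∞ = (Q ⊗ 1) x_∞ (Q ⊗ 1)⁻¹`**: the archimedean component ★ `archPart` intertwines the adelic congruence ★ `adelicUnitaryGroupCongr L Q H₀ H′`
with the archimedean congruence iso — the TERM ★ `unitaryGroupOfFormCongrOfEq (conjMixed) (Q ⊗ 1) (archFormOf H₀) (archFormOf H′) hS` of ★ `ArchCongruenceTransport`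
(`hS` from `hQ` by ★ `archFormOf_formCongr`; no new definition).  [cite: PlatonovRapinchuk1994, §2.3] [cite: BorelJacquet1979, §4.1] -/
theorem archPart_adelicUnitaryGroupCongr (Q : GL (Fin N) L)
    (hQ : ((Q : Matrix (Fin N) (Fin N) L).map (cmConjRingHom L))ᵀ * H₀ * (Q : Matrix (Fin N) (Fin N) L) = H')
    (hS : formCongr (conjMixed (↥(maximalRealSubfield L)) L (IsCMField.complexConj L)) (Matrix.GeneralLinearGroup.map (mixedEmbedding L) Q)
      (archFormOf L N H₀) = archFormOf L N H')
    (g : (cmDatum L N H').Adelic) :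
    archPart (↥(maximalRealSubfield L)) L (IsCMField.complexConj L) N H₀ (adelicUnitaryGroupCongr L Q H₀ H' hQ g) =
      unitaryGroupOfFormCongrOfEq (conjMixed (↥(maximalRealSubfield L)) L (IsCMField.complexConj L)) (Matrix.GeneralLinearGroup.map (mixedEmbedding L) Q)
        (archFormOf L N H₀) (archFormOf L N H') hS
        (archPart (↥(maximalRealSubfield L)) L (IsCMField.complexConj L) N H' g) := by
  refine Subtype.ext ?_
  rw [coe_archPart, coe_unitaryGroupOfFormCongrOfEq_apply, coe_archPart]
  change GLn.toMixed N L (toAdeleGL L Q * (g.val : GL (Fin N) (AdeleRing (𝓞 L) L)) * (toAdeleGL L Q)⁻¹) =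
    Matrix.GeneralLinearGroup.map (mixedEmbedding L) Q * GLn.toMixed N L (g.val : GL (Fin N) (AdeleRing (𝓞 L) L)) *
      (Matrix.GeneralLinearGroup.map (mixedEmbedding L) Q)⁻¹
  rw [map_mul, map_mul, map_inv, toMixed_toAdeleGL]

/-- The `adelicUnitaryGroupCongr` hypothesis `ᵗ(cQ)·H₀·Q = H′` in the `formCongr … (1 • H₀) = H′` shape that ★ `finAdelicCongr` consumes
(`a = 1`; `cmConjRingHom L` is `IsCMField.complexConj L` as a ring hom). [cite: PlatonovRapinchuk1994, §2.3] -/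
theorem formCongr_complexConj_one_smul (Q : GL (Fin N) L)
    (hQ : ((Q : Matrix (Fin N) (Fin N) L).map (cmConjRingHom L))ᵀ * H₀ * (Q : Matrix (Fin N) (Fin N) L) = H') :
    formCongr ((IsCMField.complexConj L : L ≃ₐ[↥(maximalRealSubfield L)] L) : L →+* L) Q ((1 : L) • H₀) = H' := by
  rw [one_smul]
  exact hQ

/-- **`(Q_𝔸 x Q_𝔸⁻¹)_f = Q_f x_f Q_f⁻¹`**: the finite component ★ `finPart` intertwines the adelic congruence ★ `adelicUnitaryGroupCongr L Q H₀ H′` with the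
finite-adelic congruence ★ `finAdelicCongr L⁺ L c Q one_ne_zero h₁` (`h₁` = ★ `formCongr_complexConj_one_smul`, kept as a binder so that any proof of it is
accepted).  [cite: PlatonovRapinchuk1994, §2.3, §5.1] [cite: BorelJacquet1979, §4.1] -/
theorem finPart_adelicUnitaryGroupCongr (Q : GL (Fin N) L)
    (hQ : ((Q : Matrix (Fin N) (Fin N) L).map (cmConjRingHom L))ᵀ * H₀ * (Q : Matrix (Fin N) (Fin N) L) = H')
    (h₁ : formCongr ((IsCMField.complexConj L : L ≃ₐ[↥(maximalRealSubfield L)] L) : L →+* L) Q ((1 : L) • H₀) = H')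
    (g : (cmDatum L N H').Adelic) :
    finPart (↥(maximalRealSubfield L)) L (IsCMField.complexConj L) N H₀ (adelicUnitaryGroupCongr L Q H₀ H' hQ g) =
      finAdelicCongr (↥(maximalRealSubfield L)) L (IsCMField.complexConj L) Q one_ne_zero h₁
        (finPart (↥(maximalRealSubfield L)) L (IsCMField.complexConj L) N H' g) := by
  refine Subtype.ext ?_
  rw [coe_finPart, coe_finAdelicCongr_apply, coe_finPart]
  change GLn.sndHom N L (toAdeleGL L Q * (g.val : GL (Fin N) (AdeleRing (𝓞 L) L)) * (toAdeleGL L Q)⁻¹) =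
    toFinAdeleGL L N Q * GLn.sndHom N L (g.val : GL (Fin N) (AdeleRing (𝓞 L) L)) * (toFinAdeleGL L N Q)⁻¹
  rw [map_mul, map_mul, map_inv, sndHom_toAdeleGL]

/-- **`e_{H₀}(Q_𝔸 x Q_𝔸⁻¹) = ((Q ⊗ 1) x_∞ (Q ⊗ 1)⁻¹, Q_f x_f Q_f⁻¹)`**: the product decomposition ★ `adelicProdEquiv` intertwines the adelic congruence
with the pair (archimedean congruence iso, finite-adelic congruence).  [cite: BorelJacquet1979, §4.1] [cite: PlatonovRapinchuk1994, §2.3, §5.1] -/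
theorem adelicProdEquiv_adelicUnitaryGroupCongr (Q : GL (Fin N) L)
    (hQ : ((Q : Matrix (Fin N) (Fin N) L).map (cmConjRingHom L))ᵀ * H₀ * (Q : Matrix (Fin N) (Fin N) L) = H')
    (hS : formCongr (conjMixed (↥(maximalRealSubfield L)) L (IsCMField.complexConj L)) (Matrix.GeneralLinearGroup.map (mixedEmbedding L) Q)
      (archFormOf L N H₀) = archFormOf L N H')
    (h₁ : formCongr ((IsCMField.complexConj L : L ≃ₐ[↥(maximalRealSubfield L)] L) : L →+* L) Q ((1 : L) • H₀) = H')
    (g : (cmDatum L N H').Adelic) :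
    adelicProdEquiv (↥(maximalRealSubfield L)) L (IsCMField.complexConj L) N H₀ (adelicUnitaryGroupCongr L Q H₀ H' hQ g) =
      (unitaryGroupOfFormCongrOfEq (conjMixed (↥(maximalRealSubfield L)) L (IsCMField.complexConj L)) (Matrix.GeneralLinearGroup.map (mixedEmbedding L) Q)
          (archFormOf L N H₀) (archFormOf L N H') hS
          (adelicProdEquiv (↥(maximalRealSubfield L)) L (IsCMField.complexConj L) N H' g).1,
        finAdelicCongr (↥(maximalRealSubfield L)) L (IsCMField.complexConj L) Q one_ne_zero h₁
          (adelicProdEquiv (↥(maximalRealSubfield L)) L (IsCMField.complexConj L) N H' g).2) := by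
  rw [adelicProdEquiv_apply, adelicProdEquiv_apply]
  exact Prod.ext (archPart_adelicUnitaryGroupCongr Q hQ hS g) (finPart_adelicUnitaryGroupCongr Q hQ h₁ g)

/-- **`Q_𝔸 · e_{H′}⁻¹(y, z) · Q_𝔸⁻¹ = e_{H₀}⁻¹((Q ⊗ 1) y (Q ⊗ 1)⁻¹, Q_f z Q_f⁻¹)`** — the same with the INVERSE decompositions `e_• = adelicProdEquiv.symm`
(the `e`, `hg : e (archPart g, finPart g) = g` binders of the singular covolume letters): a measure on `U(H′)(𝔸)` presented as the `e_{H′}⁻¹`-image of a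
product is carried by the adelic congruence to the `e_{H₀}⁻¹`-image of the componentwise transported product. [cite: BorelJacquet1979, §4.1] [cite: Rogawski1990, §14.5 p. 239] -/
theorem adelicUnitaryGroupCongr_adelicProdEquiv_symm (Q : GL (Fin N) L)
    (hQ : ((Q : Matrix (Fin N) (Fin N) L).map (cmConjRingHom L))ᵀ * H₀ * (Q : Matrix (Fin N) (Fin N) L) = H')
    (hS : formCongr (conjMixed (↥(maximalRealSubfield L)) L (IsCMField.complexConj L)) (Matrix.GeneralLinearGroup.map (mixedEmbedding L) Q)
      (archFormOf L N H₀) = archFormOf L N H')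
    (h₁ : formCongr ((IsCMField.complexConj L : L ≃ₐ[↥(maximalRealSubfield L)] L) : L →+* L) Q ((1 : L) • H₀) = H')
    (y : arch (↥(maximalRealSubfield L)) L (IsCMField.complexConj L) N H') (z : finAdelic (↥(maximalRealSubfield L)) L (IsCMField.complexConj L) N H') :
    adelicUnitaryGroupCongr L Q H₀ H' hQ ((adelicProdEquiv (↥(maximalRealSubfield L)) L (IsCMField.complexConj L) N H').symm (y, z)) =
      (adelicProdEquiv (↥(maximalRealSubfield L)) L (IsCMField.complexConj L) N H₀).symm
        (unitaryGroupOfFormCongrOfEq (conjMixed (↥(maximalRealSubfield L)) L (IsCMField.complexConj L)) (Matrix.GeneralLinearGroup.map (mixedEmbedding L) Q)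
            (archFormOf L N H₀) (archFormOf L N H') hS y,
          finAdelicCongr (↥(maximalRealSubfield L)) L (IsCMField.complexConj L) Q one_ne_zero h₁ z) := by
  have h := adelicProdEquiv_adelicUnitaryGroupCongr Q hQ hS h₁
    ((adelicProdEquiv (↥(maximalRealSubfield L)) L (IsCMField.complexConj L) N H').symm (y, z))
  rw [ContinuousMulEquiv.apply_symm_apply] at h
  calc adelicUnitaryGroupCongr L Q H₀ H' hQ ((adelicProdEquiv (↥(maximalRealSubfield L)) L (IsCMField.complexConj L) N H').symm (y, z))
      = (adelicProdEquiv (↥(maximalRealSubfield L)) L (IsCMField.complexConj L) N H₀).symm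
          (adelicProdEquiv (↥(maximalRealSubfield L)) L (IsCMField.complexConj L) N H₀
            (adelicUnitaryGroupCongr L Q H₀ H' hQ ((adelicProdEquiv (↥(maximalRealSubfield L)) L (IsCMField.complexConj L) N H').symm (y, z)))) :=
        ((adelicProdEquiv (↥(maximalRealSubfield L)) L (IsCMField.complexConj L) N H₀).symm_apply_apply _).symm
    _ = _ := congrArg (adelicProdEquiv (↥(maximalRealSubfield L)) L (IsCMField.complexConj L) N H₀).symm h

end CM

end UnitaryGroup

end Literature.NumberTheory.Automorphic
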